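import Mathlib.Geometry.Manifold.MFDeriv.Basic
import Mathlib.Geometry.Manifold.ContMDiff.Defs
import Mathlib.Geometry.Manifold.IsManifold.InteriorBoundary
import Mathlib.Geometry.Manifold.Instances.Sphere
import Mathlib.LinearAlgebra.QuadraticForm.Signature
import Mathlib.LinearAlgebra.SesquilinearForm.Basic
import Mathlib.Topology.Algebra.Module.ContinuousLinearMap.Basic
import Mathlib.Data.Set.Card
import HarnessLib

-- provenance: harness21/H21/H21/Prelude/FourManL/Morse.lean @ 3097bc8 (interim HEAD d8f2665); M5 mechanical rewrite
/-!
# Morse functions on manifolds (trunk FourManL, notion `kirby_calculus_handles`, layer (a))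

This file sets up the elementary calculus of Morse functions on a manifold `M` modelled on a
model with corners `I : ModelWithCorners ℝ E H`:

* `Literature.IsMCriticalPt I f x`: `x` is a critical point of `f : M → ℝ`, i.e. `mfderiv I 𝓘(ℝ, ℝ) f x = 0`;
  `Literature.criticalSet I f` is the set of critical points.
* `Literature.mhessian I f x : LinearMap.BilinForm ℝ E`: the Hessian of `f` at `x`, computed in the preferred
  extended chart at `x` (second `fderivWithin` of `writtenInExtChartAt`).
* `Literature.IsMorse I f`: `f` is smooth and every critical point is nondegenerate (Milnor 1963, §2).
* `Literature.morseIndex I f x : ℕ`: the index (`sigNeg` of the Hessian) of `f` at `x`;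
  `Literature.criticalSetOfIndex I f k` the critical points of index `k` (consumers count them with
  `Set.ncard`).
* `Literature.IsMorseAdapted I f`: a Morse function on a manifold with boundary which is `≡ 1` and
  regular on the boundary and `< 1` on the interior (Milnor 1965, Def. 3.1 with `V₀ = ∅`).
* `Literature.IsSelfIndexing I f`: `f x = index x` at every critical point (Smale 1961).

and states (with `sorry` proofs) the standard facts: finiteness of the critical set on a compact
manifold (Milnor 1963, Cor. 2.3), the Morse lemma (Morse 1934; Milnor 1963, Lemma 2.2) and Reeb's
sphere theorem (Reeb 1952; Milnor 1963, Thm. 4.1).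

## Mathlib status

Mathlib (at the pinned commit) has no Morse theory on manifolds: `Morse` only occurs in the Galois
theory of Morse polynomials. We use Mathlib's `mfderiv`, `writtenInExtChartAt`, `fderivWithin`,
`LinearMap.BilinForm.Nondegenerate`, `LinearMap.IsSymm` and the root-level signature invariant
`sigNeg` (`Mathlib/LinearAlgebra/QuadraticForm/Signature.lean`).

## Design choices

* Names `IsMCriticalPt`, `mhessian` follow Mathlib's `mfderiv`/`MDifferentiable` convention of
  prefixing the manifold version with `m`/`M`.
* The Hessian is chart-dependent in general; at a critical point its congruence class (hence
  nondegeneracy and `sigNeg`) is intrinsic, which is all that `IsMorse` and `morseIndex` use.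
* The Morse lemma and Reeb's theorem are stated for boundaryless manifolds modelled on `𝓡 n`.

## References

* M. Morse, *The calculus of variations in the large*, AMS Colloquium Publ. 18 (1934).
* J. Milnor, *Morse theory*, Ann. of Math. Studies 51 (1963), §§2–4.
* J. Milnor, *Lectures on the h-cobordism theorem*, Princeton (1965), §3.
* S. Smale, *On gradient dynamical systems*, Ann. of Math. 74 (1961).
* G. Reeb, *Sur certaines propriétés topologiques des variétés feuilletées* (1952).
-/

open scoped Manifold ContDiff
open Set Function

noncomputable section

namespace Literature.Topology.FourManifolds

local notation "𝔼 " n:arg => EuclideanSpace ℝ (Fin n)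
local notation "𝕊 " n:arg => (Metric.sphere (0 : EuclideanSpace ℝ (Fin (n + 1))) 1)

section General

variable {E H : Type*} [NormedAddCommGroup E] [NormedSpace ℝ E] [TopologicalSpace H]
  (I : ModelWithCorners ℝ E H) {M : Type*} [TopologicalSpace M] [ChartedSpace H M]

/-- `x` is a *critical point* of `f : M → ℝ`: the manifold derivative `mfderiv I 𝓘(ℝ, ℝ) f x`
vanishes (Milnor 1963, §2). Named by analogy with Mathlib's `mfderiv`.

Junk value: since `mfderiv` is `0` where `f` is not `MDifferentiableAt`, this predicate is also
(vacuously) true at points of non-differentiability; every use in H21 is under a `ContMDiff`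
hypothesis. [cite: Milnor1963, §2] -/
def IsMCriticalPt (f : M → ℝ) (x : M) : Prop :=
  mfderiv I 𝓘(ℝ, ℝ) f x = 0

/-- The *critical set* `{x | df_x = 0}` of `f : M → ℝ` (Milnor 1963, §2). [cite: Milnor1963, §2] -/
def criticalSet (f : M → ℝ) : Set M :=
  {x | IsMCriticalPt I f x}

variable {I} in
/-- Unfolding lemma for `criticalSet` (Milnor 1963, §2). [cite: Milnor1963, §2] -/
@[simp]
theorem mem_criticalSet {f : M → ℝ} {x : M} : x ∈ criticalSet I f ↔ IsMCriticalPt I f x :=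
  Iff.rfl

/-- The *Hessian* of `f : M → ℝ` at `x`, as a bilinear form on the model space `E`: the second
derivative (within `range I`) at `extChartAt I x x` of `f` written in the preferred extended chart at
`x` (Milnor 1963, §2). Named by analogy with Mathlib's `mfderiv`.

This bilinear form depends on the chart in general. At a critical point of a `C²` function its
congruence class — hence `Nondegenerate` and `sigNeg`, which is all `IsMorse` and `morseIndex`
use — is intrinsic; symmetry is `mhessian_isSymm`. [cite: Milnor1963, §2] -/
def mhessian (f : M → ℝ) (x : M) : LinearMap.BilinForm ℝ E :=
  (ContinuousLinearMap.coeLM ℝ).comp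
    (fderivWithin ℝ (fderivWithin ℝ (writtenInExtChartAt I 𝓘(ℝ, ℝ) x f) (range I)) (range I)
      (extChartAt I x x)).toLinearMap

variable {I} in
/-- The Hessian of a `C²` function is a symmetric bilinear form (symmetry of second derivatives;
Milnor 1963, §2). [cite: Milnor1963, §2] -/
def mhessian_isSymm : Prop :=
  ∀ [IsManifold I 2 M] {f : M → ℝ} (hf : ContMDiff I 𝓘(ℝ, ℝ) 2 f) (x : M),
    (mhessian I f x).IsSymm

/-- `f : M → ℝ` is a *Morse function*: it is smooth and its Hessian at every critical point is
nondegenerate (Morse 1934; Milnor 1963, §2). [cite: Morse1934] -/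
def IsMorse (f : M → ℝ) : Prop :=
  ContMDiff I 𝓘(ℝ, ℝ) ∞ f ∧ ∀ x, IsMCriticalPt I f x → (mhessian I f x).Nondegenerate

variable {I} in
/-- A Morse function is smooth (Milnor 1963, §2). [cite: Milnor1963, §2] -/
theorem IsMorse.contMDiff {f : M → ℝ} (hf : IsMorse I f) : ContMDiff I 𝓘(ℝ, ℝ) ∞ f :=
  hf.1

variable {I} in
/-- The Hessian of a Morse function at a critical point is nondegenerate (Milnor 1963, §2). [cite: Milnor1963, §2] -/
theorem IsMorse.nondegenerate {f : M → ℝ} (hf : IsMorse I f) {x : M} (hx : IsMCriticalPt I f x) :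
    (mhessian I f x).Nondegenerate :=
  hf.2 x hx

/-- The *Morse index* of `f` at `x`: the negative index of inertia `sigNeg` of the Hessian, i.e.
the maximal dimension of a subspace of `E` on which the Hessian is negative definite
(Milnor 1963, §2). Only meaningful at critical points. [cite: Milnor1963, §2] -/
def morseIndex (f : M → ℝ) (x : M) : ℕ :=
  sigNeg (mhessian I f x).toQuadraticMap

/-- The Morse index is at most the dimension of the model space (Milnor 1963, §2). [cite: Milnor1963, §2] -/
theorem morseIndex_le_finrank (f : M → ℝ) (x : M) : morseIndex I f x ≤ Module.finrank ℝ E := by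
  simpa only [morseIndex, ← sigPos_neg] using sigPos_le_finrank (-(mhessian I f x).toQuadraticMap)

/-- The set of critical points of `f` of Morse index `k` (Milnor 1963, §3). Consumers count
critical points of index `k` as `(criticalSetOfIndex I f k).ncard`; the junk value `0` of `ncard`
on infinite sets is excluded for Morse functions on compact manifolds by
`IsMorse.finite_criticalSet`. [cite: Milnor1963, §3] -/
def criticalSetOfIndex (f : M → ℝ) (k : ℕ) : Set M :=
  {x | IsMCriticalPt I f x ∧ morseIndex I f x = k}

variable {I} in
/-- Unfolding lemma for `criticalSetOfIndex` (Milnor 1963, §3). [cite: Milnor1963, §3] -/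
@[simp]
theorem mem_criticalSetOfIndex {f : M → ℝ} {k : ℕ} {x : M} :
    x ∈ criticalSetOfIndex I f k ↔ IsMCriticalPt I f x ∧ morseIndex I f x = k :=
  Iff.rfl

/-- Critical points of index `k` are critical points (Milnor 1963, §3). [cite: Milnor1963, §3] -/
theorem criticalSetOfIndex_subset (f : M → ℝ) (k : ℕ) :
    criticalSetOfIndex I f k ⊆ criticalSet I f :=
  fun _ hx => hx.1

/-- The critical set is the union over `k` of the critical points of index `k` (Milnor 1963, §3). [cite: Milnor1963, §3] -/
theorem iUnion_criticalSetOfIndex (f : M → ℝ) :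
    ⋃ k, criticalSetOfIndex I f k = criticalSet I f := by
  ext x
  simp only [mem_iUnion, mem_criticalSetOfIndex, mem_criticalSet, exists_and_left, exists_eq',
    and_true]

/-- `f` is a Morse function *adapted to the boundary* of `M`: `f` is Morse, `f ≡ 1` and has no
critical points on the boundary `I.boundary M`, and `f < 1` on the interior. Such an `f` presents a
compact manifold with boundary as a handlebody built on `∅` (Milnor 1965, Def. 3.1 with `V₀ = ∅`;
Milnor 1963, §3). [cite: Milnor1965, Def. 3.1 with  V₀ = ∅] -/
def IsMorseAdapted (f : M → ℝ) : Prop :=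
  IsMorse I f ∧ (∀ x ∈ I.boundary M, f x = 1 ∧ ¬ IsMCriticalPt I f x) ∧
    ∀ x ∈ I.interior M, f x < 1

variable {I} in
/-- A Morse function adapted to the boundary is Morse (Milnor 1965, Def. 3.1). [cite: Milnor1965, Def. 3.1] -/
theorem IsMorseAdapted.isMorse {f : M → ℝ} (hf : IsMorseAdapted I f) : IsMorse I f :=
  hf.1

/-- `f` is *self-indexing*: at every critical point the value of `f` equals the Morse index
(Smale 1961; Milnor 1965, Def. 4.9). [cite: Smale1961] -/
def IsSelfIndexing (f : M → ℝ) : Prop :=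
  ∀ x, IsMCriticalPt I f x → f x = morseIndex I f x

variable {I}

/-- Nondegenerate critical points are isolated, so a Morse function on a compact manifold has
finitely many critical points (Milnor 1963, Cor. 2.3). [cite: Milnor1963, Cor. 2.3] -/
def IsMorse.finite_criticalSet : Prop :=
  ∀ [IsManifold I ∞ M] [CompactSpace M] {f : M → ℝ} (hf : IsMorse I f),
    (criticalSet I f).Finite

/-- The critical set of a Morse function is closed (Milnor 1963, §2; continuity of `df`). [cite: Milnor1963, §2] -/
def IsMorse.isClosed_criticalSet : Prop :=
  ∀ [IsManifold I ∞ M] {f : M → ℝ} (hf : IsMorse I f),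
    IsClosed (criticalSet I f)

end General

section Euclidean

variable {n : ℕ} {M : Type*} [TopologicalSpace M] [ChartedSpace (𝔼 n) M]

/-- **Morse lemma.** Near a nondegenerate critical point `x` of a Morse function `f` on an
`n`-manifold there is a smooth chart `e` centred at `x` in which
`f ∘ e.symm (y) = f x - ∑_{i < λ} y_i ^ 2 + ∑_{i ≥ λ} y_i ^ 2`, where `λ = morseIndex (𝓡 n) f x`
(Morse 1934; Milnor 1963, Lemma 2.2). [cite: Morse1934] -/
def IsMorse.exists_chart_eq_quadratic : Prop :=
  ∀ [IsManifold (𝓡 n) ∞ M] {f : M → ℝ} (hf : IsMorse (𝓡 n) f) {x : M} (hx : IsMCriticalPt (𝓡 n) f x),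
    ∃ e : OpenPartialHomeomorph M (𝔼 n), e ∈ IsManifold.maximalAtlas (𝓡 n) ∞ M ∧
      x ∈ e.source ∧ e x = 0 ∧
      ∀ y ∈ e.target, f (e.symm y) =
        f x - ∑ i ∈ Finset.univ.filter (fun i : Fin n => i.val < morseIndex (𝓡 n) f x), (y i) ^ 2
          + ∑ i ∈ Finset.univ.filter (fun i : Fin n => morseIndex (𝓡 n) f x ≤ i.val), (y i) ^ 2

variable (n) (M : Type*) [TopologicalSpace M] [T2Space M] [SecondCountableTopology M]
  [CompactSpace M] [ChartedSpace (𝔼 n) M] [IsManifold (𝓡 n) ∞ M]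

/-- **Reeb's sphere theorem.** A closed smooth `n`-manifold admitting a Morse function with exactly
two critical points is homeomorphic to the `n`-sphere (Reeb 1952; Milnor 1963, Thm. 4.1 and
Remark). Only *homeomorphic*: `M` may carry an exotic smooth structure (Milnor 1956). [cite: Reeb1952] -/
def nonempty_homeomorph_sphere_of_ncard_criticalSet_eq_two : Prop :=
  ∀ (f : M → ℝ) (hf : IsMorse (𝓡 n) f) (h2 : (criticalSet (𝓡 n) f).ncard = 2),
    Nonempty (M ≃ₜ (𝕊 n))

end Euclidean

end Literature.Topology.FourManifolds
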